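import Summits.QuantumFields.BalabanUV.Beta.NVertexLamCorePeriodised
import Summits.QuantumFields.BalabanUV.Beta.FP.TorusTwoScaleSandwichLetters

/-!
# `BalabanUV.Beta.NVertexLamSectorPeriodisedStoreys` — row D1 ∕ (C1), PART 17: **THE RIGHT SIDE OF THE ROAD's `hΛN`, IN CLOSED FORM — `dper T ΛN` on the finest
# torus `T = towerTorus Lc (fine Lc M) j` IS the storey sum of the `compLinKer`-sandwiches of the PERIODISED row cores: per storey `k ≤ j`, legs over the
# finest bonds' upper boxes, and in the middle `−cΛ · Σ_κ Σ_{r ∈ pbox (towerTorus Lc M (j−k))} (Σ'_m λ′ᴿ_k (κ, r + ·)) · dper (towerTorus Lc (fine Lc M) (j−k)) (𝒽 κ r|ff)`**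
# (PART 15's display through the road's own engine `TorusTwoScaleSandwichLetters.dper_sandwich_apply`, with PART 16's core letter and core identity)

WHY (located).  Road FP g38's (E4b-shape) `FP/TorusLamJunctionShape.lamJunction_of_dper_eq` (p469378 ✓) leaves ONE identity
`hΛN : dper T (Σ_{j' ∈ range (n+2)} 𝒦_{j'}) = dper T ΛN`, `T := towerTorus Lc (fine Lc (Mc B)) (n+1)`.  PART 16 §4 (`dper_lamN_eq_dper_LN`) identified its right side with
`cΛ · dper T (ℒN μ y|ff)`, PART 15 (`LN_inl_inl_eq_sum_storeySandwich`) displayed `cΛ · ℒN|ff = Σ_{k ≤ j} 𝒦ᴿ_k` in the road's `h𝒦` sandwich shape, PART 16 §1–§3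
periodised each core `𝒢ᴿ_k` on its storey torus.  THIS FILE runs the road's engine on the row's sandwiches: §1 the legs of a block-covariant brick list are
two-scale equivariant between a storey torus `Tc` and the finest torus `towerTorus L Tc k` above it (`compLinKer_translate_of_sh`: an2 g60 `compLinKer_sh`; the
road's `rowsLeg_translate` is the same for its scaled bricks), so (§2, the record) `dper (towerTorus Lc Tc k) 𝒦ᴿ_k = legs · dper Tc 𝒢ᴿ_k · legs` over the legs'
upper boxes (**`dper_storeySandwichR_apply`**: `dper_sandwich_apply` with PART 15's box letter `compLinKer_eq_zero_of_not_mem_box`, PART 16's core letter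
`summable_lamCoreR_diag`; the window-free display converted by `sandwich_tsum_eq_window`), the sandwich's own diagonal letter (`summable_storeySandwichR_diag`), and
with PART 16's `dper_lamCoreR_apply_reps` the periodised core in the middle is «periodised weight × periodised brick over the slot torus»
(**`dper_storeySandwichR_apply_reps`**); §3 on the wrapper's tower `T = towerTorus Lc (fine Lc M) j` (every storey torus `towerTorus Lc (fine Lc M) (j−k)` sits `k`
levels below it: `towerTorus_towerTorus`-arithmetic) the storeys ADD under `dper T` (**`dper_sum_storeySandwichR`**) and, with PART 15 + PART 16 §4,
**`dper_lamN_eq_sum_dper_storeys`** ∕ **`dper_lamN_closed_form`**: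
  `dper T ΛN x z a b = Σ_{k ∈ range (j+1)} Σ_{a₁ a₁'} Σ_{γ ∈ Box_k x} Σ_{γ' ∈ Box_k z} compLinKer ℓ Lc k (a,x) (a₁,γ) · (−cΛ · Σ_κ Σ_{r ∈ pbox (towerTorus Lc M (j−k))}
   (Σ'_m λ′ᴿ_k (κ, r + (towerTorus Lc M (j−k))∘m)) · dper (towerTorus Lc (fine Lc M) (j−k)) (𝒽 κ r)♭ γ γ' a₁ a₁') · compLinKer ℓ Lc k (b,z) (a₁',γ')`
— at `j := n+1`, `R := Roots.ctr Lc` this is the right side of `hΛN` with NOTHING of the row left implicit: the road's left side `dper T (Σ 𝒦_{j'})` unpacks by the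
same engine into its own legs (= these up to the per-step scalars `stepScale · Lc⁴` of `hℓ`) around `dper (storey torus) (w j' · Σ_ā hb j' ā · (SLam N₁ (cf j') 𝒽 ā)|ff)`,
so (J-Λ-lat) IS, storey by storey (`j' = j − k`), the CORE junction on the slot representatives — SPEC-49 §B's weight word with `λ′_k := λ′ᴿ_k`.

WHAT ([folklore] bookkeeping BY NAME; no `def`, no `def … : Prop`, nothing cited, 0 sorry): §1 `compLinKer_translate_of_sh`, `compLinKer_of_scaled_bricks`,
`ctr_eq_toSite_ctr_r`, `compLinKer_road_eq_scaled` (the road's legs = the record's legs × one scalar per storey); §2 `dper_storeySandwichR_apply`,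
`summable_storeySandwichR_diag`, `dper_storeySandwichR_apply_reps`; §3 `towerTorus_sub_add`, `dper_sum_storeySandwichR`, **`dper_lamN_eq_sum_dper_storeys`**,
**`dper_lamN_closed_form`**.
WHAT THIS IS NOT: not (J-Λ-lat) itself (the road's `w ∕ hb ∕ cf` instantiation, its leg scalars and its core's periodisation are the road's); not (K1) for the
nested column; not (J-W)∕(J-X) (road FP g39 Q-FP-39-1 ∕ R-FP-79; the Λ half is slice-blind — nothing here consumes R-FP-77 (ii)); no row of the END wrapper
discharged; 0 estimates; nothing of Bałaban's asserted, valued or discharged; 0∕4 row-D1 binders (hW, hR, D1Tel, D1Rep); ROOT M‴ p325680 ∕ P5c ∕ D6 untouched;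
NOT (C1), NOT (L2′), NOT D1, NEVER «G-an2-4 closed», NOT BetaPertH, NOT continuum, NOT Clay.

HONEST DEPENDENCY (page 1, mandatory): continuum YM on T⁴ ⇐ BetaPertH ∧ nine spine estimates (0/9 proved); BetaPertH ⇐ (D1) ∧ (D4) ∧ CAP+tail;
G-an2-4 gates asym, D1 and NE2/3/4.  HONEST FRAMING (cell contract, verbatim): «discharging `BetaPertH` makes Bałaban's UV stability UNCONDITIONAL —
a real constructive-QFT result; it is NOT the continuum limit and NOT the Clay problem.»  ABSOLUTE RULE (cell charter, verbatim): «No internally-minted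
statement may enter as a cited fact. Every hypothesis is either kernel-proved in this package or a verbatim quotation of a PUBLISHED theorem with page
reference. The manuscript(s) under audit are NOT citable for their own disputed steps — they are the thing under adjudication; programme-internal
(2001/route/tribunal) claims are never citable.»  Row D1 ∕ (C1) OWNER an2 (b2b-balaban-beta-an2) gen 62, 2026-08-27.  No existing file touched.
-/

noncomputable section

open scoped BigOperators

namespace Summit.QuantumFields.BalabanUV.Beta.NVertexLamSectorPeriodisedStoreys

open Finset
open Literature.MathematicalPhysics.QuantumFieldTheory
open Literature.MathematicalPhysics.QuantumFieldTheory.Balaban1983to89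
open Literature.MathematicalPhysics.QuantumFieldTheory.Balaban1983to89.Beta
open B4TorusKernel.MultiPeriod (translate)
open B5Prop11Plancherel (fine)
open B6Lemma24Torus (pbox)
open AffineAveraging (Site box toSite)
open AveragingHessianKernels (Bond Near ell)
open ExpKernelCalculus (MKer)
open OneStepResolventKernel (Fib KInv)
open OneStepKernelFamily (vertexOfK)
open InterLevelTransport (SLam)
open BalabanStepJets (lamCoeffOf)
open Summit.QuantumFields.BalabanUV.Beta.AxialDressingRooted (one_le_of_neZero)
open Summit.QuantumFields.BalabanUV.Beta.SymAveragingHessianCounts (symLinKerAt symHessKerAt symLinKerAt_add)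
open AveragingContoursRooted (ctr)
open Summit.QuantumFields.BalabanUV.Beta.BorderedHessian (stepScale)
open Summit.QuantumFields.BalabanUV.Beta.CompositeVertexKernelRec (compLinKer wid compLinKer_sh compLinKer_zero compLinKer_succ)
open Summit.QuantumFields.BalabanUV.Beta.CompositeOneShotJets (compH)
open Summit.QuantumFields.BalabanUV.Beta.CompositeOneShotJetData (Roots Pins AN)
open Summit.QuantumFields.BalabanUV.Beta.FP.KernelPeriodisationFib (perF translate_eq_add)
open Summit.QuantumFields.BalabanUV.Beta.FP.KernelPeriodisationFibLoc (dper dper_apply)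
open Summit.QuantumFields.BalabanUV.Beta.FP.TorusGaugeCovariancePairing (wrapPt)
open Summit.QuantumFields.BalabanUV.Beta.FP.TorusCompositeObjects (towerTorus towerTorus_apply)
open Summit.QuantumFields.BalabanUV.Beta.FP.TorusTwoScaleSandwichLetters (dper_sandwich_apply sandwich_tsum_eq_window summable_sandwich_diag_of_tsum)
open Summit.QuantumFields.BalabanUV.Beta.NVertexLamSectorStoreyKernels (compLinKer_eq_zero_of_not_mem_box LN_inl_inl_eq_sum_storeySandwich)
open Summit.QuantumFields.BalabanUV.Beta.NVertexLamCorePeriodised (summable_lamCoreR_diag dper_lamCoreR_apply_reps towerTorus_fine_apply_eq dper_lamN_eq_dper_LN)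

variable {d : ℕ}

/-! ## §1 Generic: the legs of a block-covariant brick list are two-scale equivariant -/

section Legs

variable {ℓ : ℕ → Fin (d + 1) → Site (d + 1) → Bond (d + 1) → ℝ} {L : ℕ}

/-- [folklore] **`compLinKer_translate_of_sh` — THE LEG IS TWO-SCALE EQUIVARIANT**: for a block-covariant brick list (`ℓ i μ (y + t) (f.sh (L•t)) = ℓ i μ y f`) and any
storey torus `Tc`, translating the storey bond by `Tc∘m` and the finest bond by `(towerTorus L Tc k)∘m = L^k • (Tc∘m)` leaves `compLinKer ℓ L k` unchanged (an2 g60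
`compLinKer_sh`; the engine's `hCL`). -/
theorem compLinKer_translate_of_sh (hℓsh : ∀ i μ y t f, ℓ i μ (y + t) (f.sh ((L : ℤ) • t)) = ℓ i μ y f) (Tc : Fin (d + 1) → ℕ) (k : ℕ)
    (m γ : Site (d + 1)) (a : Fin (d + 1)) (β : Site (d + 1)) (b : Fin (d + 1)) :
    compLinKer ℓ L k (b, translate (towerTorus L Tc k) β m) (a, translate Tc γ m) = compLinKer ℓ L k (b, β) (a, γ) := by
  set t : Site (d + 1) := fun i => (Tc i : ℤ) * m i with ht
  have h1 : ((a, translate Tc γ m) : Bond (d + 1)) = Bond.sh (a, γ) t := by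
    unfold Bond.sh
    exact Prod.ext rfl (translate_eq_add Tc γ m)
  have h2 : ((b, translate (towerTorus L Tc k) β m) : Bond (d + 1)) = Bond.sh (b, β) (((L : ℤ) ^ k) • t) := by
    unfold Bond.sh
    refine Prod.ext rfl (funext fun i => ?_)
    show translate (towerTorus L Tc k) β m i = β i + (((L : ℤ) ^ k) • t) i
    rw [B4TorusKernel.MultiPeriod.translate_apply, towerTorus_apply, Pi.smul_apply, smul_eq_mul, ht, Nat.cast_mul, Nat.cast_pow]
    ring
  rw [h1, h2]
  exact compLinKer_sh hℓsh k (b, β) (a, γ) t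

/-- [folklore] **`compLinKer_of_scaled_bricks` — SCALED BRICKS SCALE THE LEG**: if `ℓ′ i = c i · ℓ i` for every step `i < K`, then for every depth `m ≤ K`
`compLinKer ℓ′ L m f g = (Π_{i<m} c i) · compLinKer ℓ L m f g` (induction over an2 g60's `compLinKer_succ`) — the per-step scalars of the road's `hℓ` come out of its legs. -/
theorem compLinKer_of_scaled_bricks {ℓ' : ℕ → Fin (d + 1) → Site (d + 1) → Bond (d + 1) → ℝ} (c : ℕ → ℝ) {K : ℕ}
    (hℓ' : ∀ i < K, ∀ (μ : Fin (d + 1)) (y : Site (d + 1)) (g : Bond (d + 1)), ℓ' i μ y g = c i * ℓ i μ y g) :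
    ∀ m ≤ K, ∀ (f g : Bond (d + 1)), compLinKer ℓ' L m f g = (∏ i ∈ range m, c i) * compLinKer ℓ L m f g
  | 0, _, f, g => by rw [Finset.prod_range_zero, one_mul, compLinKer_zero, compLinKer_zero]
  | m + 1, hm, f, g => by
      rw [compLinKer_succ, compLinKer_succ, Finset.prod_range_succ, Finset.mul_sum]
      refine Finset.sum_congr rfl fun κ _ => ?_
      rw [Finset.mul_sum]
      refine Finset.sum_congr rfl fun e _ => ?_
      rw [hℓ' m (by omega), compLinKer_of_scaled_bricks c hℓ' m (by omega)]
      ring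

omit L in
/-- [folklore] the road's brick root IS the record's: `ctr 4 Lc = toSite (Roots.ctr Lc).r` (`rfl`). -/
theorem ctr_eq_toSite_ctr_r (Lc : ℕ) [NeZero Lc] : ctr (3 + 1) Lc = toSite (Roots.ctr Lc).r := rfl

/-- [folklore] **`compLinKer_road_eq_scaled`** — AT THE ROAD's DISPLAYED BRICK LIST (`hℓ` of `TorusLamJunctionShape` ∕ `TorusHSideJetPeriodic`: `ℓ i μ y g =
stepScale 3 Lc (lev (n+1−i)) · (Lc⁴ · symLinKerAt (ctr 4 Lc) Lc μ y g)` for `i < n+1`): for `k ≤ n+1`, `compLinKer ℓ Lc k = (Π_{i<k} stepScale 3 Lc (lev (n+1−i)) · Lc⁴) ·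
compLinKer (fun _ => symLinKerAt (toSite (Roots.ctr Lc).r) Lc) Lc k` — the road's legs are the record's legs times ONE scalar per storey. -/
theorem compLinKer_road_eq_scaled (Lc : ℕ) [NeZero Lc] (n : ℕ) (lev : ℕ → ℕ) {ℓ' : ℕ → Fin (3 + 1) → Site (3 + 1) → Bond (3 + 1) → ℝ}
    (hℓ : ∀ i < n + 1, ∀ (μ : Fin (3 + 1)) (y : Site (3 + 1)) (g : Bond (3 + 1)),
      ℓ' i μ y g = stepScale 3 Lc (lev (n + 1 - i)) * ((Lc : ℝ) ^ (3 + 1) * symLinKerAt (ctr (3 + 1) Lc) Lc μ y g))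
    (k : ℕ) (hk : k ≤ n + 1) (f g : Bond (3 + 1)) :
    compLinKer ℓ' Lc k f g = (∏ i ∈ range k, stepScale 3 Lc (lev (n + 1 - i)) * (Lc : ℝ) ^ (3 + 1))
      * compLinKer (fun _ => symLinKerAt (toSite (Roots.ctr Lc).r) Lc) Lc k f g :=
  compLinKer_of_scaled_bricks (ℓ := fun _ => symLinKerAt (toSite (Roots.ctr Lc).r) Lc) (L := Lc)
    (fun i => stepScale 3 Lc (lev (n + 1 - i)) * (Lc : ℝ) ^ (3 + 1)) (K := n + 1) (fun i hi μ y g => by rw [hℓ i hi, mul_assoc]; rfl) k hk f g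

end Legs

/-! ## §2 At the record: one storey sandwich through the road's engine -/

section Record

variable {Lc : ℕ} [NeZero Lc] (R : Roots Lc) (P : Pins) (j : ℕ) (Tc Tc' : Fin (3 + 1) → ℕ) [∀ i, NeZero (Tc' i)]

/-- [folklore] **`dper_storeySandwichR_apply` — THE DIAGONAL PERIODISATION OF THE ROW's STOREY SANDWICH ON THE FINEST TORUS ABOVE THE STOREY TORUS IS THE
SANDWICH OF THE PERIODISED CORE** (the road's `dper_sandwich_apply` at `Tf := towerTorus Lc Tc k`, legs `compLinKer ℓ Lc k` with the box letter of PART 15 and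
`compLinKer_translate_of_sh`, core letter `summable_lamCoreR_diag` of PART 16; `Tc i = Lc · Tc′ i`). -/
theorem dper_storeySandwichR_apply (hT : ∀ i, Tc i = Lc * Tc' i) (k : ℕ) (μ : Fin (3 + 1)) (y β β' : Site (3 + 1)) (b b' : Fin (3 + 1)) :
    dper (towerTorus Lc Tc k) (fun x z (a₀ b₀ : Fin (3 + 1)) => ∑ a : Fin (3 + 1), ∑ a' : Fin (3 + 1), ∑' γ : Site (3 + 1), ∑' γ' : Site (3 + 1),
        compLinKer (fun _ => symLinKerAt (toSite R.r) Lc) Lc k (a₀, x) (a, γ)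
          * (-(P.cΛ (j + 1)) * ∑ κ : Fin (3 + 1), ∑' s : Site (3 + 1),
              (∑ ν : Fin (3 + 1), ∑' w : Site (3 + 1),
                  (∑ κ' : Fin (3 + 1), ∑' u : Site (3 + 1),
                      AN R j u (((Lc ^ (j + 1) : ℕ) : ℤ) • y) (Sum.inl κ') (Sum.inr μ)
                        * lamCoeffOf (KInv (N := Lc ^ (j + 1)) (d := 3)) (Lc ^ (j + 1)) ν w κ' u)
                    * compLinKer (fun _ => symLinKerAt (toSite R.r) Lc) Lc (j - k) (κ, s) (ν, w))
                * symHessKerAt (toSite R.r) Lc κ s (a, γ) (a', γ'))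
          * compLinKer (fun _ => symLinKerAt (toSite R.r) Lc) Lc k (b₀, z) (a', γ')) β β' b b'
      = ∑ a : Fin (3 + 1), ∑ a' : Fin (3 + 1),
          ∑ γ ∈ Fintype.piFinset (fun i => Finset.Icc ((β i - (wid Lc k : ℤ)) / ((Lc ^ k : ℕ) : ℤ)) (β i / ((Lc ^ k : ℕ) : ℤ))),
            ∑ γ' ∈ Fintype.piFinset (fun i => Finset.Icc ((β' i - (wid Lc k : ℤ)) / ((Lc ^ k : ℕ) : ℤ)) (β' i / ((Lc ^ k : ℕ) : ℤ))),
              compLinKer (fun _ => symLinKerAt (toSite R.r) Lc) Lc k (b, β) (a, γ)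
                * dper Tc (fun x x' (c c' : Fin (3 + 1)) => -(P.cΛ (j + 1)) * ∑ κ : Fin (3 + 1), ∑' s : Site (3 + 1),
                    (∑ ν : Fin (3 + 1), ∑' w : Site (3 + 1),
                        (∑ κ' : Fin (3 + 1), ∑' u : Site (3 + 1),
                            AN R j u (((Lc ^ (j + 1) : ℕ) : ℤ) • y) (Sum.inl κ') (Sum.inr μ)
                              * lamCoeffOf (KInv (N := Lc ^ (j + 1)) (d := 3)) (Lc ^ (j + 1)) ν w κ' u)
                          * compLinKer (fun _ => symLinKerAt (toSite R.r) Lc) Lc (j - k) (κ, s) (ν, w))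
                      * symHessKerAt (toSite R.r) Lc κ s (c, x) (c', x')) γ γ' a a'
                * compLinKer (fun _ => symLinKerAt (toSite R.r) Lc) Lc k (b', β') (a', γ') := by
  have hL : 0 < Lc := Nat.pos_of_ne_zero (NeZero.ne Lc)
  have hTc' : ∀ i, 1 ≤ Tc' i := fun i => one_le_of_neZero (Tc' i)
  exact dper_sandwich_apply Tc (towerTorus Lc Tc k) (fun γ a β b => compLinKer (fun _ => symLinKerAt (toSite R.r) Lc) Lc k (b, β) (a, γ))
    (fun m γ a β b => compLinKer_translate_of_sh (fun _ μ' y' t f => symLinKerAt_add (toSite R.r) Lc μ' y' t f) Tc k m γ a β b)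
    (fun β => Fintype.piFinset (fun i => Finset.Icc ((β i - (wid Lc k : ℤ)) / ((Lc ^ k : ℕ) : ℤ)) (β i / ((Lc ^ k : ℕ) : ℤ))))
    (fun γ a β b h => compLinKer_eq_zero_of_not_mem_box hL k (b, β) a h) _
    (sandwich_tsum_eq_window (fun γ a β b => compLinKer (fun _ => symLinKerAt (toSite R.r) Lc) Lc k (b, β) (a, γ))
      (fun β => Fintype.piFinset (fun i => Finset.Icc ((β i - (wid Lc k : ℤ)) / ((Lc ^ k : ℕ) : ℤ)) (β i / ((Lc ^ k : ℕ) : ℤ))))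
      (fun γ a β b h => compLinKer_eq_zero_of_not_mem_box hL k (b, β) a h) _ (fun _ _ _ _ => rfl))
    (summable_lamCoreR_diag R P j Tc Tc' hT hTc' k μ y) β β' b b'

/-- [folklore] **`summable_storeySandwichR_diag` — THE STOREY SANDWICH's DIAGONAL LETTER ON THE FINEST TORUS ABOVE ITS STOREY TORUS** (the road's
`summable_sandwich_diag_of_tsum` with the same data). -/
theorem summable_storeySandwichR_diag (hT : ∀ i, Tc i = Lc * Tc' i) (k : ℕ) (μ : Fin (3 + 1)) (y β β' : Site (3 + 1)) (b b' : Fin (3 + 1)) :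
    Summable fun m₀ : Site (3 + 1) => (fun x z (a₀ b₀ : Fin (3 + 1)) => ∑ a : Fin (3 + 1), ∑ a' : Fin (3 + 1), ∑' γ : Site (3 + 1), ∑' γ' : Site (3 + 1),
        compLinKer (fun _ => symLinKerAt (toSite R.r) Lc) Lc k (a₀, x) (a, γ)
          * (-(P.cΛ (j + 1)) * ∑ κ : Fin (3 + 1), ∑' s : Site (3 + 1),
              (∑ ν : Fin (3 + 1), ∑' w : Site (3 + 1),
                  (∑ κ' : Fin (3 + 1), ∑' u : Site (3 + 1),
                      AN R j u (((Lc ^ (j + 1) : ℕ) : ℤ) • y) (Sum.inl κ') (Sum.inr μ)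
                        * lamCoeffOf (KInv (N := Lc ^ (j + 1)) (d := 3)) (Lc ^ (j + 1)) ν w κ' u)
                    * compLinKer (fun _ => symLinKerAt (toSite R.r) Lc) Lc (j - k) (κ, s) (ν, w))
                * symHessKerAt (toSite R.r) Lc κ s (a, γ) (a', γ'))
          * compLinKer (fun _ => symLinKerAt (toSite R.r) Lc) Lc k (b₀, z) (a', γ'))
      (translate (towerTorus Lc Tc k) β m₀) (translate (towerTorus Lc Tc k) β' m₀) b b' := by
  have hL : 0 < Lc := Nat.pos_of_ne_zero (NeZero.ne Lc)
  have hTc' : ∀ i, 1 ≤ Tc' i := fun i => one_le_of_neZero (Tc' i)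
  exact summable_sandwich_diag_of_tsum Tc (towerTorus Lc Tc k) (fun γ a β b => compLinKer (fun _ => symLinKerAt (toSite R.r) Lc) Lc k (b, β) (a, γ))
    (fun m γ a β b => compLinKer_translate_of_sh (fun _ μ' y' t f => symLinKerAt_add (toSite R.r) Lc μ' y' t f) Tc k m γ a β b)
    (fun β => Fintype.piFinset (fun i => Finset.Icc ((β i - (wid Lc k : ℤ)) / ((Lc ^ k : ℕ) : ℤ)) (β i / ((Lc ^ k : ℕ) : ℤ))))
    (fun γ a β b h => compLinKer_eq_zero_of_not_mem_box hL k (b, β) a h) _ (fun _ _ _ _ => rfl)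
    (summable_lamCoreR_diag R P j Tc Tc' hT hTc' k μ y) β β' b b'

/-- [folklore] **`dper_storeySandwichR_apply_reps` — THE SAME WITH THE PERIODISED CORE WRITTEN OVER THE SLOT TORUS** (PART 16 `dper_lamCoreR_apply_reps` in the
middle): legs over the finest bonds' boxes around `−cΛ · Σ_κ Σ_{r ∈ pbox Tc′} (Σ'_m λ′ᴿ_k (κ, r + Tc′∘m)) · dper Tc (𝒽 κ r)♭`. -/
theorem dper_storeySandwichR_apply_reps (hT : ∀ i, Tc i = Lc * Tc' i) (k : ℕ) (μ : Fin (3 + 1)) (y β β' : Site (3 + 1)) (b b' : Fin (3 + 1)) :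
    dper (towerTorus Lc Tc k) (fun x z (a₀ b₀ : Fin (3 + 1)) => ∑ a : Fin (3 + 1), ∑ a' : Fin (3 + 1), ∑' γ : Site (3 + 1), ∑' γ' : Site (3 + 1),
        compLinKer (fun _ => symLinKerAt (toSite R.r) Lc) Lc k (a₀, x) (a, γ)
          * (-(P.cΛ (j + 1)) * ∑ κ : Fin (3 + 1), ∑' s : Site (3 + 1),
              (∑ ν : Fin (3 + 1), ∑' w : Site (3 + 1),
                  (∑ κ' : Fin (3 + 1), ∑' u : Site (3 + 1),
                      AN R j u (((Lc ^ (j + 1) : ℕ) : ℤ) • y) (Sum.inl κ') (Sum.inr μ)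
                        * lamCoeffOf (KInv (N := Lc ^ (j + 1)) (d := 3)) (Lc ^ (j + 1)) ν w κ' u)
                    * compLinKer (fun _ => symLinKerAt (toSite R.r) Lc) Lc (j - k) (κ, s) (ν, w))
                * symHessKerAt (toSite R.r) Lc κ s (a, γ) (a', γ'))
          * compLinKer (fun _ => symLinKerAt (toSite R.r) Lc) Lc k (b₀, z) (a', γ')) β β' b b'
      = ∑ a : Fin (3 + 1), ∑ a' : Fin (3 + 1),
          ∑ γ ∈ Fintype.piFinset (fun i => Finset.Icc ((β i - (wid Lc k : ℤ)) / ((Lc ^ k : ℕ) : ℤ)) (β i / ((Lc ^ k : ℕ) : ℤ))),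
            ∑ γ' ∈ Fintype.piFinset (fun i => Finset.Icc ((β' i - (wid Lc k : ℤ)) / ((Lc ^ k : ℕ) : ℤ)) (β' i / ((Lc ^ k : ℕ) : ℤ))),
              compLinKer (fun _ => symLinKerAt (toSite R.r) Lc) Lc k (b, β) (a, γ)
                * (-(P.cΛ (j + 1)) * ∑ κ : Fin (3 + 1), ∑ r : ↥(pbox Tc'),
                    (∑' m : Site (3 + 1), ∑ ν : Fin (3 + 1), ∑' w : Site (3 + 1),
                        (∑ κ' : Fin (3 + 1), ∑' u : Site (3 + 1),
                            AN R j u (((Lc ^ (j + 1) : ℕ) : ℤ) • y) (Sum.inl κ') (Sum.inr μ)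
                              * lamCoeffOf (KInv (N := Lc ^ (j + 1)) (d := 3)) (Lc ^ (j + 1)) ν w κ' u)
                          * compLinKer (fun _ => symLinKerAt (toSite R.r) Lc) Lc (j - k) (κ, translate Tc' (r : Site (3 + 1)) m) (ν, w))
                      * dper Tc (fun x x' (c c' : Fin (3 + 1)) => symHessKerAt (toSite R.r) Lc κ (r : Site (3 + 1)) (c, x) (c', x')) γ γ' a a')
                * compLinKer (fun _ => symLinKerAt (toSite R.r) Lc) Lc k (b', β') (a', γ') := by
  rw [dper_storeySandwichR_apply R P j Tc Tc' hT k μ y β β' b b']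
  simp only [dper_lamCoreR_apply_reps R P j Tc Tc' hT k μ y]

end Record

/-! ## §3 On the wrapper's tower: the storeys add under `dper T`, and `dper T ΛN` in closed form -/

section Tower

variable {Lc : ℕ} [NeZero Lc] (R : Roots Lc) (P : Pins) (j : ℕ) (M : Fin (3 + 1) → ℕ) [∀ i, NeZero (M i)]

omit [NeZero Lc] [∀ i, NeZero (M i)] in
/-- [folklore] the finest torus of the tower sits `k` levels above the storey torus `towerTorus Lc (fine Lc M) (j − k)` for `k ≤ j` (`towerTorus_apply` arithmetic). -/
theorem towerTorus_sub_add {k : ℕ} (hk : k ≤ j) : towerTorus Lc (towerTorus Lc (fine Lc M) (j - k)) k = towerTorus Lc (fine Lc M) j := by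
  funext i
  rw [towerTorus_apply, towerTorus_apply, towerTorus_apply, ← mul_assoc, ← pow_add, Nat.add_sub_cancel' hk]

/-- [folklore] **`dper_sum_storeySandwichR` — THE STOREY SANDWICHES ADD UNDER `dper T`** on the wrapper's finest torus `T := towerTorus Lc (fine Lc M) j`
(each storey's diagonal letter from `summable_storeySandwichR_diag` on its own storey torus, re-based by `towerTorus_sub_add`). -/
theorem dper_sum_storeySandwichR (μ : Fin (3 + 1)) (y β β' : Site (3 + 1)) (b b' : Fin (3 + 1)) :
    dper (towerTorus Lc (fine Lc M) j) (fun x z (a₀ b₀ : Fin (3 + 1)) => ∑ k ∈ range (j + 1),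
        ∑ a : Fin (3 + 1), ∑ a' : Fin (3 + 1), ∑' γ : Site (3 + 1), ∑' γ' : Site (3 + 1),
          compLinKer (fun _ => symLinKerAt (toSite R.r) Lc) Lc k (a₀, x) (a, γ)
            * (-(P.cΛ (j + 1)) * ∑ κ : Fin (3 + 1), ∑' s : Site (3 + 1),
                (∑ ν : Fin (3 + 1), ∑' w : Site (3 + 1),
                    (∑ κ' : Fin (3 + 1), ∑' u : Site (3 + 1),
                        AN R j u (((Lc ^ (j + 1) : ℕ) : ℤ) • y) (Sum.inl κ') (Sum.inr μ)
                          * lamCoeffOf (KInv (N := Lc ^ (j + 1)) (d := 3)) (Lc ^ (j + 1)) ν w κ' u)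
                      * compLinKer (fun _ => symLinKerAt (toSite R.r) Lc) Lc (j - k) (κ, s) (ν, w))
                  * symHessKerAt (toSite R.r) Lc κ s (a, γ) (a', γ'))
            * compLinKer (fun _ => symLinKerAt (toSite R.r) Lc) Lc k (b₀, z) (a', γ')) β β' b b'
      = ∑ k ∈ range (j + 1), dper (towerTorus Lc (towerTorus Lc (fine Lc M) (j - k)) k)
          (fun x z (a₀ b₀ : Fin (3 + 1)) => ∑ a : Fin (3 + 1), ∑ a' : Fin (3 + 1), ∑' γ : Site (3 + 1), ∑' γ' : Site (3 + 1),
            compLinKer (fun _ => symLinKerAt (toSite R.r) Lc) Lc k (a₀, x) (a, γ)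
              * (-(P.cΛ (j + 1)) * ∑ κ : Fin (3 + 1), ∑' s : Site (3 + 1),
                  (∑ ν : Fin (3 + 1), ∑' w : Site (3 + 1),
                      (∑ κ' : Fin (3 + 1), ∑' u : Site (3 + 1),
                          AN R j u (((Lc ^ (j + 1) : ℕ) : ℤ) • y) (Sum.inl κ') (Sum.inr μ)
                            * lamCoeffOf (KInv (N := Lc ^ (j + 1)) (d := 3)) (Lc ^ (j + 1)) ν w κ' u)
                        * compLinKer (fun _ => symLinKerAt (toSite R.r) Lc) Lc (j - k) (κ, s) (ν, w))
                    * symHessKerAt (toSite R.r) Lc κ s (a, γ) (a', γ'))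
              * compLinKer (fun _ => symLinKerAt (toSite R.r) Lc) Lc k (b₀, z) (a', γ')) β β' b b' := by
  rw [dper_apply]
  -- every storey's diagonal translates are summable on `T` (its letter on `towerTorus Lc Tc_k k`, re-based)
  have hk : ∀ k ∈ range (j + 1), Summable fun m₀ : Site (3 + 1) =>
      (fun x z (a₀ b₀ : Fin (3 + 1)) => ∑ a : Fin (3 + 1), ∑ a' : Fin (3 + 1), ∑' γ : Site (3 + 1), ∑' γ' : Site (3 + 1),
          compLinKer (fun _ => symLinKerAt (toSite R.r) Lc) Lc k (a₀, x) (a, γ)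
            * (-(P.cΛ (j + 1)) * ∑ κ : Fin (3 + 1), ∑' s : Site (3 + 1),
                (∑ ν : Fin (3 + 1), ∑' w : Site (3 + 1),
                    (∑ κ' : Fin (3 + 1), ∑' u : Site (3 + 1),
                        AN R j u (((Lc ^ (j + 1) : ℕ) : ℤ) • y) (Sum.inl κ') (Sum.inr μ)
                          * lamCoeffOf (KInv (N := Lc ^ (j + 1)) (d := 3)) (Lc ^ (j + 1)) ν w κ' u)
                      * compLinKer (fun _ => symLinKerAt (toSite R.r) Lc) Lc (j - k) (κ, s) (ν, w))
                  * symHessKerAt (toSite R.r) Lc κ s (a, γ) (a', γ'))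
            * compLinKer (fun _ => symLinKerAt (toSite R.r) Lc) Lc k (b₀, z) (a', γ'))
        (translate (towerTorus Lc (fine Lc M) j) β m₀) (translate (towerTorus Lc (fine Lc M) j) β' m₀) b b' := fun k hk => by
    have hkj : k ≤ j := Nat.lt_succ_iff.mp (Finset.mem_range.mp hk)
    have h := summable_storeySandwichR_diag R P j (towerTorus Lc (fine Lc M) (j - k)) (towerTorus Lc M (j - k)) (towerTorus_fine_apply_eq M (j - k)) k μ y β β' b b'
    rwa [towerTorus_sub_add j M hkj] at h
  rw [Summable.tsum_finsetSum hk]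
  refine Finset.sum_congr rfl fun k hk' => ?_
  rw [dper_apply, towerTorus_sub_add j M (Nat.lt_succ_iff.mp (Finset.mem_range.mp hk'))]

/-- [folklore] **`dper_lamN_eq_sum_dper_storeys` — THE RIGHT SIDE OF THE ROAD's `hΛN` IS THE STOREY SUM OF THE PERIODISED ROW SANDWICHES**:
on `T := towerTorus Lc (fine Lc M) j`,
`dper T ΛN x z a b = Σ_{k ∈ range (j+1)} dper (towerTorus Lc (towerTorus Lc (fine Lc M) (j−k)) k) 𝒦ᴿ_k x z a b` (PART 16 §4 + PART 15 + `dper_sum_storeySandwichR`). -/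
theorem dper_lamN_eq_sum_dper_storeys (μ : Fin (3 + 1)) (y x z : Site (3 + 1)) (a b : Fin (3 + 1)) :
    dper (towerTorus Lc (fine Lc M) j) (fun x' z' (a' b' : Fin (3 + 1)) => P.cΛ (j + 1) * ∑ b₀ : ↥(pbox (towerTorus Lc (fine Lc M) j)) × Fin (3 + 1),
        perF (towerTorus Lc (fine Lc M) j) (AN R j) (b₀.1, Sum.inl b₀.2) (wrapPt (towerTorus Lc (fine Lc M) j) (((Lc ^ (j + 1) : ℕ) : ℤ) • y), Sum.inr μ)
          * SLam (Lc ^ (j + 1)) (lamCoeffOf (KInv (N := Lc ^ (j + 1)) (d := 3)) (Lc ^ (j + 1))) (compH R.r Lc (j + 1)) b₀.2 (b₀.1 : Site (3 + 1))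
              x' z' (Sum.inl a') (Sum.inl b')) x z a b
      = ∑ k ∈ range (j + 1), dper (towerTorus Lc (towerTorus Lc (fine Lc M) (j - k)) k)
          (fun x' z' (a₀ b₀ : Fin (3 + 1)) => ∑ a₁ : Fin (3 + 1), ∑ a₁' : Fin (3 + 1), ∑' γ : Site (3 + 1), ∑' γ' : Site (3 + 1),
            compLinKer (fun _ => symLinKerAt (toSite R.r) Lc) Lc k (a₀, x') (a₁, γ)
              * (-(P.cΛ (j + 1)) * ∑ κ : Fin (3 + 1), ∑' s : Site (3 + 1),
                  (∑ ν : Fin (3 + 1), ∑' w : Site (3 + 1),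
                      (∑ κ' : Fin (3 + 1), ∑' u : Site (3 + 1),
                          AN R j u (((Lc ^ (j + 1) : ℕ) : ℤ) • y) (Sum.inl κ') (Sum.inr μ)
                            * lamCoeffOf (KInv (N := Lc ^ (j + 1)) (d := 3)) (Lc ^ (j + 1)) ν w κ' u)
                        * compLinKer (fun _ => symLinKerAt (toSite R.r) Lc) Lc (j - k) (κ, s) (ν, w))
                    * symHessKerAt (toSite R.r) Lc κ s (a₁, γ) (a₁', γ'))
              * compLinKer (fun _ => symLinKerAt (toSite R.r) Lc) Lc k (b₀, z') (a₁', γ')) x z a b := by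
  have hT : ∀ i, Lc ^ (j + 1) ∣ towerTorus Lc (fine Lc M) j i := fun i =>
    ⟨M i, by rw [towerTorus_apply]; show Lc ^ j * (Lc * M i) = Lc ^ (j + 1) * M i; rw [pow_succ]; ring⟩
  rw [dper_lamN_eq_dper_LN R j (towerTorus Lc (fine Lc M) j) hT (P.cΛ (j + 1)) μ y x z a b, ← dper_sum_storeySandwichR R P j M μ y x z a b,
    dper_apply, dper_apply, ← tsum_mul_left]
  exact tsum_congr fun m => LN_inl_inl_eq_sum_storeySandwich R P j μ y _ _ a b

/-- [folklore] **`dper_lamN_closed_form` — THE RIGHT SIDE OF `hΛN` WITH NOTHING OF THE ROW LEFT IMPLICIT**: on `T := towerTorus Lc (fine Lc M) j`,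
`dper T ΛN x z a b = Σ_{k ∈ range (j+1)} Σ_{a₁ a₁'} Σ_{γ ∈ Box_k x} Σ_{γ' ∈ Box_k z} compLinKer ℓ Lc k (a,x) (a₁,γ) · (−cΛ · Σ_κ Σ_{r ∈ pbox (towerTorus Lc M (j−k))}
(Σ'_m λ′ᴿ_k (κ, r + (towerTorus Lc M (j−k))∘m)) · dper (towerTorus Lc (fine Lc M) (j−k)) (𝒽 κ r)♭ γ γ' a₁ a₁') · compLinKer ℓ Lc k (b,z) (a₁',γ')`. -/
theorem dper_lamN_closed_form (μ : Fin (3 + 1)) (y x z : Site (3 + 1)) (a b : Fin (3 + 1)) :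
    dper (towerTorus Lc (fine Lc M) j) (fun x' z' (a' b' : Fin (3 + 1)) => P.cΛ (j + 1) * ∑ b₀ : ↥(pbox (towerTorus Lc (fine Lc M) j)) × Fin (3 + 1),
        perF (towerTorus Lc (fine Lc M) j) (AN R j) (b₀.1, Sum.inl b₀.2) (wrapPt (towerTorus Lc (fine Lc M) j) (((Lc ^ (j + 1) : ℕ) : ℤ) • y), Sum.inr μ)
          * SLam (Lc ^ (j + 1)) (lamCoeffOf (KInv (N := Lc ^ (j + 1)) (d := 3)) (Lc ^ (j + 1))) (compH R.r Lc (j + 1)) b₀.2 (b₀.1 : Site (3 + 1))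
              x' z' (Sum.inl a') (Sum.inl b')) x z a b
      = ∑ k ∈ range (j + 1), ∑ a₁ : Fin (3 + 1), ∑ a₁' : Fin (3 + 1),
          ∑ γ ∈ Fintype.piFinset (fun i => Finset.Icc ((x i - (wid Lc k : ℤ)) / ((Lc ^ k : ℕ) : ℤ)) (x i / ((Lc ^ k : ℕ) : ℤ))),
            ∑ γ' ∈ Fintype.piFinset (fun i => Finset.Icc ((z i - (wid Lc k : ℤ)) / ((Lc ^ k : ℕ) : ℤ)) (z i / ((Lc ^ k : ℕ) : ℤ))),
              compLinKer (fun _ => symLinKerAt (toSite R.r) Lc) Lc k (a, x) (a₁, γ)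
                * (-(P.cΛ (j + 1)) * ∑ κ : Fin (3 + 1), ∑ r : ↥(pbox (towerTorus Lc M (j - k))),
                    (∑' m : Site (3 + 1), ∑ ν : Fin (3 + 1), ∑' w : Site (3 + 1),
                        (∑ κ' : Fin (3 + 1), ∑' u : Site (3 + 1),
                            AN R j u (((Lc ^ (j + 1) : ℕ) : ℤ) • y) (Sum.inl κ') (Sum.inr μ)
                              * lamCoeffOf (KInv (N := Lc ^ (j + 1)) (d := 3)) (Lc ^ (j + 1)) ν w κ' u)
                          * compLinKer (fun _ => symLinKerAt (toSite R.r) Lc) Lc (j - k)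
                              (κ, translate (towerTorus Lc M (j - k)) (r : Site (3 + 1)) m) (ν, w))
                      * dper (towerTorus Lc (fine Lc M) (j - k))
                          (fun x' x'' (c c' : Fin (3 + 1)) => symHessKerAt (toSite R.r) Lc κ (r : Site (3 + 1)) (c, x') (c', x'')) γ γ' a₁ a₁')
                * compLinKer (fun _ => symLinKerAt (toSite R.r) Lc) Lc k (b, z) (a₁', γ') := by
  rw [dper_lamN_eq_sum_dper_storeys R P j M μ y x z a b]
  exact Finset.sum_congr rfl fun k _ =>
    dper_storeySandwichR_apply_reps R P j (towerTorus Lc (fine Lc M) (j - k)) (towerTorus Lc M (j - k)) (towerTorus_fine_apply_eq M (j - k)) k μ y x z a b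

end Tower

end Summit.QuantumFields.BalabanUV.Beta.NVertexLamSectorPeriodisedStoreys

end
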